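import Summits.AtomisticToContinuum.Crystallization.Theorems.PalmUnimodularRigidityLayeredLawsSelectHcpZeroStressSymmetry
import Summits.AtomisticToContinuum.Crystallization.Theorems.PalmUnimodularRigidityLayeredLawsSelectHcpSublatticeForce
import Summits.AtomisticToContinuum.Crystallization.Theorems.EnergyDerivativeOrderDanskinStepHcpSums
import Literature.MathematicalPhysics.StatisticalMechanics.HcpHomogeneous
import Summits.AtomisticToContinuum.Crystallization.Theorems.ExcessDecayLiouvillePhononStabilityCertFrame

/-!
# `StrictSplittingRule` (stmt-AtomisticToContinuum-12560), line `birth`, stub `stub_coreFirstOrderDesign` (H1):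
# I. hcp index geometry and lattice sums for the first-order design

Helper file (no item closed) for the first-order design of the relaxed hcp crystal `y = hcpSite a h : ℤ³ → ℝ³`,
which routes the radial loads `W′(‖y_q − y_p‖²)(y_q − y_p)` along the four BRAVAIS index directions
`Y = {(0,1,0), (0,0,1), (0,−1,1), (2,0,0)}` (site vectors `u`, `v`, `v − u`, `2h e₃`).  Index-side facts:
* covariance `y_{q+d} − y_q = y_d` (even layer `q`) / `−y_{−d}` (odd layer) (`h1_sub_eq`); lines `h1_line`;
* the stencil vectors: squared lengths `a², a², a², 4h²`, the HALF-INTEGRALITY `⟪y_d, y_s⟫ ∈ (‖y_s‖²/2)·ℤ`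
  (`h1_inner_halfInt`; every index line is symmetric about the foot of the perpendicular from the root), and the
  frame identity `Σ_{s∈Y} λ_s ⟪x, y_s⟫ y_s = x`, `λ = 2/(3a²)` (in-layer), `1/(4h²)` (vertical) (`h1_frame`);
* lattice sums: `Σ_d (1 + ‖y_d‖)⁻ⁿ < ∞`, `n ≥ 4` (`h1_summable_one_add_inv_pow`, from the landed
  `PeriodicConfiguration.summable_inv_pow_dist`), the root force `Σ_d W′(‖y_d‖²)⟪y_d, x⟫ = 0` (`h1_force_zero`,
  from `hcpForce_eq_zero`) and the stress form `Σ_d W′(‖y_d‖²)⟪y_d, x⟫² = Σ x_l x_m S_lm` (`h1_stressForm`);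
* one-dimensional facts: antisymmetric `ℤ`-series vanish, the telescoping tail bound
  `Σ_{m ≥ 1} (r + m ε)⁻⁷ ≤ r⁻⁶/(6ε)` (`h1_tail_bound`), `|W′(σ)| ≤ C σ⁻⁴`, and for one load line `n ↦ v + n e` of
  `ℝ³` read along `e` (`x ↦ W′(‖x‖²)⟪x, e⟫`) its antisymmetry when `⟪v, e⟫ ∈ (‖e‖²/2)ℤ` (`h1_T_antisymm`).
All `[folklore]`.
-/
noncomputable section

namespace Summit.AtomisticToContinuum.Crystallization.Theorems.StrictSplittingRuleBirth

open scoped BigOperators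
open Literature.MathematicalPhysics.StatisticalMechanics
open Summit.AtomisticToContinuum.Crystallization.Theorems.PalmUnimodularRigidity.LayeredLawsSelectHcp
open Summit.AtomisticToContinuum.Crystallization.Theorems.PhononStabilityCWC.Cert (inner_fin3)

/-! ## §1 Bravais covariance of the site map -/

/-- Translating by an even-layer index is a translation of the crystal: `y_{q+d} − y_q = y_d`. [folklore] -/
theorem h1_sub_of_even (a h : ℝ) {q : ℤ × ℤ × ℤ} (hq : Even q.1) (d : ℤ × ℤ × ℤ) :
    hcpSite a h (q + d) - hcpSite a h q = hcpSite a h d := by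
  rw [sub_eq_iff_eq_add']
  exact (hcp_add_of_even a h hq q.2.1 q.2.2 d.1 d.2.1 d.2.2).symm

/-- From an odd-layer site the crystal is seen point-reflected: `y_{q+d} − y_q = −y_{−d}`. [folklore] -/
theorem h1_sub_of_odd (a h : ℝ) {q : ℤ × ℤ × ℤ} (hq : Odd q.1) (d : ℤ × ℤ × ℤ) :
    hcpSite a h (q + d) - hcpSite a h q = -hcpSite a h (-d) := by
  have h1 : haggLabel alternatingHagg q.1 = 1 := haggLabel_alternating_of_odd hq
  rcases Int.even_or_odd d.1 with hd | hd
  · have h2 : haggLabel alternatingHagg (q.1 + d.1) = 1 := haggLabel_alternating_of_odd (hq.add_even hd)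
    have h3 : haggLabel alternatingHagg (-d.1) = 0 := haggLabel_alternating_of_even (even_neg.2 hd)
    ext l
    fin_cases l <;> simp [hcpSite_apply_zero, hcpSite_apply_one, hcpSite_apply_two, h1, h2, h3] <;> ring
  · have h2 : haggLabel alternatingHagg (q.1 + d.1) = 0 := haggLabel_alternating_of_even (hq.add_odd hd)
    have h3 : haggLabel alternatingHagg (-d.1) = 1 := haggLabel_alternating_of_odd hd.neg
    ext l
    fin_cases l <;> simp [hcpSite_apply_zero, hcpSite_apply_one, hcpSite_apply_two, h1, h2, h3] <;> ring

/-- **Covariance**: `y_{q+d} − y_q = [q even] y_d − [q odd] y_{−d}`. [folklore] -/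
theorem h1_sub_eq (a h : ℝ) (q d : ℤ × ℤ × ℤ) :
    hcpSite a h (q + d) - hcpSite a h q = if Even q.1 then hcpSite a h d else -hcpSite a h (-d) := by
  split_ifs with hq
  · exact h1_sub_of_even a h hq d
  · exact h1_sub_of_odd a h (Int.not_even_iff_odd.1 hq) d

/-- An even-layer index is negated by the point reflection: `y_{−d} = −y_d`. [folklore] -/
theorem h1_neg_of_even (a h : ℝ) {d : ℤ × ℤ × ℤ} (hd : Even d.1) : hcpSite a h (-d) = -hcpSite a h d := by
  have := h1_sub_of_even a h hd (-d)
  rw [add_neg_cancel, hcpSite_zero, zero_sub] at this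
  exact this.symm

/-- **Index lines**: `y_{d + n•s} = y_d + n • y_s` along an even-layer direction `s`. [folklore] -/
theorem h1_line (a h : ℝ) {s : ℤ × ℤ × ℤ} (hs : Even s.1) (d : ℤ × ℤ × ℤ) (n : ℤ) :
    hcpSite a h (d + n • s) = hcpSite a h d + (n : ℝ) • hcpSite a h s := by
  have hns : Even (n • s).1 := by simpa using hs.mul_left n
  have h0 : haggLabel alternatingHagg s.1 = 0 := haggLabel_alternating_of_even hs
  have h1 : haggLabel alternatingHagg (n * s.1) = 0 := haggLabel_alternating_of_even (hs.mul_left n)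
  have hsm : hcpSite a h (n • s) = (n : ℝ) • hcpSite a h s := by
    ext l
    fin_cases l <;> simp [hcpSite_apply_zero, hcpSite_apply_one, hcpSite_apply_two, h0, h1] <;> ring
  have key := h1_sub_of_even a h hns d
  rw [add_comm, sub_eq_iff_eq_add'] at key
  rw [key, hsm, add_comm]

/-! ## §2 The four stencil vectors -/

/-- The stencil directions lie in even layers. [folklore] -/
theorem h1_stencil_even {s : ℤ × ℤ × ℤ}
    (hs : s ∈ ({(0, 1, 0), (0, 0, 1), (0, -1, 1), (2, 0, 0)} : Finset (ℤ × ℤ × ℤ))) : Even s.1 := by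
  simp only [Finset.mem_insert, Finset.mem_singleton] at hs
  rcases hs with rfl | rfl | rfl | rfl <;> decide

/-- Coordinates of the four stencil vectors `u = (a,0,0)`, `v = (a/2, a√3/2, 0)`, `v − u`, `2h e₃`. [folklore] -/
theorem h1_stencil_coord (a h : ℝ) :
    (hcpSite a h (0, 1, 0) 0 = a ∧ hcpSite a h (0, 1, 0) 1 = 0 ∧ hcpSite a h (0, 1, 0) 2 = 0) ∧
    (hcpSite a h (0, 0, 1) 0 = a / 2 ∧ hcpSite a h (0, 0, 1) 1 = a * √3 / 2 ∧ hcpSite a h (0, 0, 1) 2 = 0) ∧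
    (hcpSite a h (0, -1, 1) 0 = -(a / 2) ∧ hcpSite a h (0, -1, 1) 1 = a * √3 / 2 ∧
      hcpSite a h (0, -1, 1) 2 = 0) ∧
    (hcpSite a h (2, 0, 0) 0 = 0 ∧ hcpSite a h (2, 0, 0) 1 = 0 ∧ hcpSite a h (2, 0, 0) 2 = 2 * h) := by
  have h2 : haggLabel alternatingHagg 2 = 0 := haggLabel_alternating_of_even even_two
  simp [hcpSite_apply_zero, hcpSite_apply_one, hcpSite_apply_two, h2]
  constructor <;> ring

/-- Squared lengths of the stencil vectors: `a²` in the layer, `4h²` for `2h e₃`. [folklore] -/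
theorem h1_stencil_norm_sq (a h : ℝ) {s : ℤ × ℤ × ℤ}
    (hs : s ∈ ({(0, 1, 0), (0, 0, 1), (0, -1, 1), (2, 0, 0)} : Finset (ℤ × ℤ × ℤ))) :
    ‖hcpSite a h s‖ ^ 2 = if s.1 = 0 then a ^ 2 else 4 * h ^ 2 := by
  obtain ⟨⟨u0, u1, u2⟩, ⟨v0, v1, v2⟩, ⟨w0, w1, w2⟩, ⟨z0, z1, z2⟩⟩ := h1_stencil_coord a h
  have h3 : (√3 : ℝ) ^ 2 = 3 := Real.sq_sqrt (by norm_num)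
  simp only [Finset.mem_insert, Finset.mem_singleton] at hs
  rcases hs with rfl | rfl | rfl | rfl
  · rw [norm_sq_eq_three, u0, u1, u2]; simp
  · rw [norm_sq_eq_three, v0, v1, v2]; simp; nlinarith [h3]
  · rw [norm_sq_eq_three, w0, w1, w2]; simp; nlinarith [h3]
  · rw [norm_sq_eq_three, z0, z1, z2]; simp; ring

/-- **Half-integrality**: `⟪y_d, y_s⟫ = (‖y_s‖²/2)·N` with `N ∈ ℤ` for every index `d` and stencil direction
`s` (`N = 2i + j + L`, `i + 2j + L`, `j − i`, `k` for `d = (k,i,j)` with letter `L`). [folklore] -/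
theorem h1_inner_halfInt (a h : ℝ) {s : ℤ × ℤ × ℤ}
    (hs : s ∈ ({(0, 1, 0), (0, 0, 1), (0, -1, 1), (2, 0, 0)} : Finset (ℤ × ℤ × ℤ))) (d : ℤ × ℤ × ℤ) :
    ∃ N : ℤ, inner ℝ (hcpSite a h d) (hcpSite a h s) = ‖hcpSite a h s‖ ^ 2 / 2 * N := by
  rw [h1_stencil_norm_sq a h hs, inner_fin3]
  obtain ⟨⟨u0, u1, u2⟩, ⟨v0, v1, v2⟩, ⟨w0, w1, w2⟩, ⟨z0, z1, z2⟩⟩ := h1_stencil_coord a h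
  have h3 : (√3 : ℝ) ^ 2 = 3 := Real.sq_sqrt (by norm_num)
  simp only [Finset.mem_insert, Finset.mem_singleton] at hs
  rcases hs with rfl | rfl | rfl | rfl
  · refine ⟨2 * d.2.1 + d.2.2 + haggLabel alternatingHagg d.1, ?_⟩
    rw [u0, u1, u2, hcpSite_apply_zero]; push_cast; simp; ring
  · refine ⟨d.2.1 + 2 * d.2.2 + haggLabel alternatingHagg d.1, ?_⟩
    rw [v0, v1, v2, hcpSite_apply_zero, hcpSite_apply_one]; push_cast; simp; linear_combination
      (a ^ 2 * ((d.2.2 : ℝ) + haggLabel alternatingHagg d.1 / 3) / 4) * h3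
  · refine ⟨d.2.2 - d.2.1, ?_⟩
    rw [w0, w1, w2, hcpSite_apply_zero, hcpSite_apply_one]; push_cast; simp; linear_combination
      (a ^ 2 * ((d.2.2 : ℝ) + haggLabel alternatingHagg d.1 / 3) / 4) * h3
  · refine ⟨d.1, ?_⟩
    rw [z0, z1, z2, hcpSite_apply_two]; simp; ring

/-- **The frame identity** `Σ_{s ∈ Y} λ_s ⟪x, y_s⟫ y_s = x` (`λ = 2/(3a²)` in the layer, `1/(4h²)` for `2h e₃`;
the three in-layer directions at `0, π/3, 2π/3` form a tight frame of constant `3a²/2`). [folklore] -/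
theorem h1_frame {a h : ℝ} (ha : a ≠ 0) (hh : h ≠ 0) (x : EuclideanSpace ℝ (Fin 3)) :
    ∑ s ∈ ({(0, 1, 0), (0, 0, 1), (0, -1, 1), (2, 0, 0)} : Finset (ℤ × ℤ × ℤ)),
      ((if s.1 = 0 then 2 / (3 * a ^ 2) else 1 / (4 * h ^ 2)) * inner ℝ x (hcpSite a h s)) • hcpSite a h s =
      x := by
  obtain ⟨⟨u0, u1, u2⟩, ⟨v0, v1, v2⟩, ⟨w0, w1, w2⟩, ⟨z0, z1, z2⟩⟩ := h1_stencil_coord a h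
  have h3 : (√3 : ℝ) ^ 2 = 3 := Real.sq_sqrt (by norm_num)
  rw [Finset.sum_insert (by decide), Finset.sum_insert (by decide), Finset.sum_insert (by decide),
    Finset.sum_singleton]
  simp only [inner_fin3, u0, u1, u2, v0, v1, v2, w0, w1, w2, z0, z1, z2]
  ext l
  fin_cases l
  · simp [u0, v0, w0, z0]; field_simp; ring
  · simp [u1, v1, w1, z1]; field_simp; linear_combination (2 * x 1) * h3
  · simp [u2, v2, w2, z2]; field_simp; ring

/-! ## §3 Non-degeneracy of the site map -/

/-- Every site other than the root is at distance `≥ min a h` from it (`a, h > 0`). [folklore] -/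
theorem h1_norm_ge {a h : ℝ} (ha : 0 < a) (hh : 0 < h) {d : ℤ × ℤ × ℤ} (hd : d ≠ 0) :
    min a h ≤ ‖hcpSite a h d‖ := by
  have h1 : min (a ^ 2) (h ^ 2) ≤ ‖hcpSite a h d‖ ^ 2 := by
    rw [hcpSite_norm_sq]; exact min_sq_le_hcpRadicand a h hd
  have h0 : 0 ≤ min a h := le_min ha.le hh.le
  have h2 : (min a h) ^ 2 ≤ min (a ^ 2) (h ^ 2) :=
    le_min (pow_le_pow_left₀ h0 (min_le_left _ _) 2) (pow_le_pow_left₀ h0 (min_le_right _ _) 2)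
  exact (pow_le_pow_iff_left₀ h0 (norm_nonneg _) two_ne_zero).1 (h2.trans h1)

/-! ## §4 Lattice sums -/

/-- **Inverse powers `n > 3` of the site norms are summable over `ℤ³`** (the landed Epstein-type bound
`PeriodicConfiguration.summable_inv_pow_dist`, re-indexed by the injective site map). [folklore] -/
theorem h1_summable_inv_pow {a h : ℝ} (ha : a ≠ 0) (hh : h ≠ 0) {n : ℕ} (hn : 3 < n) :
    Summable fun d : ℤ × ℤ × ℤ => if d = 0 then (0 : ℝ) else (‖hcpSite a h d‖⁻¹) ^ n := by
  have hinj := EnergyDerivativeOrderDanskin.hcp_injective ha hh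
  have hS := EnergyDerivativeOrderDanskin.mem_hcp_points_iff ha hh
  have h0 : (fun v : ℤ × ℤ × ℤ => barlowPos a h alternatingHagg v.1 v.2.1 v.2.2) 0 = 0 :=
    barlowPos_alternating_zero a h
  set F : EuclideanSpace ℝ (Fin 3) → ℝ := fun y => (dist (0 : EuclideanSpace ℝ (Fin 3)) y)⁻¹ ^ n with hF
  have hsum := (hcpPeriodicConfiguration ha hh).summable_inv_pow_dist hn (0 : EuclideanSpace ℝ (Fin 3))
  have h1 : Summable ({y | y ∈ (hcpPeriodicConfiguration ha hh).points ∧ y ≠ 0}.indicator F) :=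
    (summable_subtype_iff_indicator (s := {y | y ∈ (hcpPeriodicConfiguration ha hh).points ∧ y ≠ 0})
      (f := F)).1 hsum
  have h2 : Summable ({y | y ∈ (hcpPeriodicConfiguration ha hh).points ∧ y ≠ 0}.indicator F ∘
      fun v : ℤ × ℤ × ℤ => barlowPos a h alternatingHagg v.1 v.2.1 v.2.2) := by
    refine (hinj.summable_iff fun y hy => ?_).2 h1
    by_contra hne
    exact hy (EnergyDerivativeOrderDanskin.support_indicator_subset_range hS F (Function.mem_support.2 hne))
  refine h2.congr fun v => ?_
  rw [Function.comp_apply, EnergyDerivativeOrderDanskin.indicator_comp_eq_ite hinj h0 hS F]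
  by_cases hv : v = 0
  · simp [hv]
  · simp only [hv, if_false, hF, dist_comm (0 : EuclideanSpace ℝ (Fin 3)), dist_zero_right]
    rfl

/-- **`Σ_d (1 + ‖y_d‖)⁻ⁿ < ∞` for `n > 3`** (`a, h > 0`). [folklore] -/
theorem h1_summable_one_add_inv_pow {a h : ℝ} (ha : 0 < a) (hh : 0 < h) {n : ℕ} (hn : 3 < n) :
    Summable fun d : ℤ × ℤ × ℤ => ((1 + ‖hcpSite a h d‖)⁻¹) ^ n := by
  have hs := h1_summable_inv_pow ha.ne' hh.ne' hn
  have hfin : Summable fun d : ℤ × ℤ × ℤ => if d = 0 then (1 : ℝ) else 0 := (hasSum_ite_eq 0 1).summable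
  refine Summable.of_nonneg_of_le (fun d => by positivity) (fun d => ?_) (hfin.add hs)
  by_cases hd : d = 0
  · simp [hd, hcpSite_zero]
  · simp only [hd, if_false, zero_add]
    have hpos : 0 < ‖hcpSite a h d‖ := (lt_min ha hh).trans_le (h1_norm_ge ha hh hd)
    exact pow_le_pow_left₀ (by positivity) (inv_anti₀ hpos (by linarith)) n

/-! ## §5 Two one-dimensional facts and the bound on `W′` -/

/-- A `ℤ`-series antisymmetric under an affine involution `n ↦ −N − n` vanishes (no summability needed: a
non-summable series is `0` too). [folklore] -/
theorem h1_tsum_eq_zero_of_antisymm {f : ℤ → ℝ} (N : ℤ) (hf : ∀ n, f (-N - n) = -f n) : ∑' n, f n = 0 := by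
  have e : ∑' n, f (-N - n) = ∑' n, f n := (Equiv.subLeft (-N)).tsum_eq f
  rw [show (fun n => f (-N - n)) = fun n => -f n from funext hf, tsum_neg] at e
  linarith

/-- Tangent-line (convexity) inequality for `t ↦ t⁻⁶`: `6 ε (x+ε)⁻⁷ ≤ x⁻⁶ − (x+ε)⁻⁶` (`x, ε > 0`). [folklore] -/
theorem h1_inv_pow_six_step {x ε : ℝ} (hx : 0 < x) (hε : 0 < ε) :
    6 * ε * ((x + ε)⁻¹) ^ 7 ≤ (x⁻¹) ^ 6 - ((x + ε)⁻¹) ^ 6 := by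
  have hy : 0 < x + ε := by positivity
  rw [inv_pow, inv_pow, inv_pow, ← sub_nonneg]
  have key : (x ^ 6)⁻¹ - ((x + ε) ^ 6)⁻¹ - 6 * ε * ((x + ε) ^ 7)⁻¹ =
      ε ^ 2 * (21 * x ^ 5 + 35 * x ^ 4 * ε + 35 * x ^ 3 * ε ^ 2 + 21 * x ^ 2 * ε ^ 3 + 7 * x * ε ^ 4 +
        ε ^ 5) / (x ^ 6 * (x + ε) ^ 7) := by
    field_simp
    ring
  rw [key]
  positivity

/-- **Telescoping tail bound**: `Σ_{m ≥ 0} (r + (m+1) ε)⁻⁷ ≤ r⁻⁶ / (6 ε)` and the series converges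
(`r, ε > 0`). [folklore] -/
theorem h1_tail_bound {r ε : ℝ} (hr : 0 < r) (hε : 0 < ε) :
    (Summable fun m : ℕ => ((r + (m + 1) * ε)⁻¹) ^ 7) ∧
      ∑' m : ℕ, ((r + (m + 1) * ε)⁻¹) ^ 7 ≤ (r⁻¹) ^ 6 / (6 * ε) := by
  have hpart : ∀ n : ℕ, ∑ m ∈ Finset.range n, ((r + (m + 1) * ε)⁻¹) ^ 7 ≤
      ((r⁻¹) ^ 6 - ((r + n * ε)⁻¹) ^ 6) / (6 * ε) := by
    intro n
    induction n with
    | zero => simp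
    | succ n ih =>
      rw [Finset.sum_range_succ]
      have hx : 0 < r + n * ε := by positivity
      have step := h1_inv_pow_six_step hx hε
      have e1 : r + n * ε + ε = r + ((n : ℝ) + 1) * ε := by ring
      rw [e1] at step
      push_cast
      rw [le_div_iff₀ (by positivity)] at ih ⊢
      nlinarith [step]
  have hbound : ∀ n : ℕ, ∑ m ∈ Finset.range n, ((r + (m + 1) * ε)⁻¹) ^ 7 ≤ (r⁻¹) ^ 6 / (6 * ε) := fun n =>
    (hpart n).trans (div_le_div_of_nonneg_right (sub_le_self _ (by positivity)) (by positivity))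
  have hnn : ∀ m : ℕ, 0 ≤ ((r + (m + 1) * ε)⁻¹) ^ 7 := fun m => by positivity
  exact ⟨summable_of_sum_range_le hnn hbound, Real.tsum_le_of_sum_range_le hnn hbound⟩

/-- `|W′(σ)| ≤ ½ (1 + σ₀⁻³) σ⁻⁴` for `σ ≥ σ₀ > 0`. [folklore] -/
theorem h1_abs_ljSqDeriv_le {σ₀ σ : ℝ} (h0 : 0 < σ₀) (hσ : σ₀ ≤ σ) :
    |ljSqDeriv σ| ≤ 1 / 2 * (1 + (σ₀⁻¹) ^ 3) * (σ⁻¹) ^ 4 := by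
  have hs : 0 < σ := h0.trans_le hσ
  have hi : σ⁻¹ ≤ σ₀⁻¹ := (inv_le_inv₀ hs h0).2 hσ
  have hi0 : 0 ≤ σ⁻¹ := inv_nonneg.2 hs.le
  have h7 : (σ⁻¹) ^ 7 ≤ (σ₀⁻¹) ^ 3 * (σ⁻¹) ^ 4 := by
    rw [show (σ⁻¹) ^ 7 = (σ⁻¹) ^ 3 * (σ⁻¹) ^ 4 by ring]
    exact mul_le_mul_of_nonneg_right (pow_le_pow_left₀ hi0 hi 3) (by positivity)
  unfold ljSqDeriv
  rw [abs_mul, abs_of_nonneg (by norm_num : (0 : ℝ) ≤ 1 / 2), mul_assoc]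
  refine mul_le_mul_of_nonneg_left ?_ (by norm_num)
  calc |(σ⁻¹) ^ 4 - (σ⁻¹) ^ 7| ≤ |(σ⁻¹) ^ 4| + |(σ⁻¹) ^ 7| := abs_sub _ _
    _ = (σ⁻¹) ^ 4 + (σ⁻¹) ^ 7 := by rw [abs_of_nonneg (by positivity), abs_of_nonneg (by positivity)]
    _ ≤ _ := by nlinarith [h7]

/-! ## §6 The root force and the stress form as lattice sums -/

/-- **Zero force on the root** in vector form: `Σ_d W′(‖y_d‖²)⟪y_d, x⟫ = 0`, with summability (the `D_3h`
site symmetry, `hcpForce_eq_zero`; `a, h ≠ 0`). [folklore] -/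
theorem h1_force_zero {a h : ℝ} (ha : a ≠ 0) (hh : h ≠ 0) (x : EuclideanSpace ℝ (Fin 3)) :
    (Summable fun d : ℤ × ℤ × ℤ => ljSqDeriv (‖hcpSite a h d‖ ^ 2) * inner ℝ (hcpSite a h d) x) ∧
      ∑' d : ℤ × ℤ × ℤ, ljSqDeriv (‖hcpSite a h d‖ ^ 2) * inner ℝ (hcpSite a h d) x = 0 := by
  have hχ1 : ∀ k : ℤ, |(fun _ : ℤ => (1 : ℝ)) k| ≤ 1 := fun _ => by simp
  have hχe : ∀ k : ℤ, (fun _ : ℤ => (1 : ℝ)) (-k) = (fun _ : ℤ => (1 : ℝ)) k := fun _ => rfl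
  have hsum : ∀ l : Fin 3, Summable fun d : ℤ × ℤ × ℤ =>
      ljSqDeriv (‖hcpSite a h d‖ ^ 2) * hcpSite a h d l := fun l => by
    simpa using summable_hcpForceTerm ha hh hχ1 l
  have hzero : ∀ l : Fin 3, ∑' d : ℤ × ℤ × ℤ, ljSqDeriv (‖hcpSite a h d‖ ^ 2) * hcpSite a h d l = 0 :=
    fun l => by simpa using hcpForce_eq_zero ha hh hχe hχ1 l
  have hterm : ∀ d : ℤ × ℤ × ℤ, ljSqDeriv (‖hcpSite a h d‖ ^ 2) * inner ℝ (hcpSite a h d) x =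
      ∑ l : Fin 3, x l * (ljSqDeriv (‖hcpSite a h d‖ ^ 2) * hcpSite a h d l) := fun d => by
    rw [inner_fin3, Fin.sum_univ_three]; ring
  simp_rw [hterm]
  refine ⟨summable_sum fun l _ => (hsum l).mul_left (x l), ?_⟩
  rw [Summable.tsum_finsetSum fun l _ => (hsum l).mul_left (x l)]
  simp [tsum_mul_left, hzero]

/-- **The stress form**: `Σ_d W′(‖y_d‖²)⟪y_d, x⟫² = Σ_{l,m} x_l x_m S_lm`, with summability (`a, h ≠ 0`).
[folklore] -/
theorem h1_stressForm {a h : ℝ} (ha : a ≠ 0) (hh : h ≠ 0) (x : EuclideanSpace ℝ (Fin 3)) :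
    (Summable fun d : ℤ × ℤ × ℤ => ljSqDeriv (‖hcpSite a h d‖ ^ 2) * inner ℝ (hcpSite a h d) x ^ 2) ∧
      ∑' d : ℤ × ℤ × ℤ, ljSqDeriv (‖hcpSite a h d‖ ^ 2) * inner ℝ (hcpSite a h d) x ^ 2 =
        ∑ l : Fin 3, ∑ m : Fin 3, x l * x m * hcpSiteStress a h l m := by
  have hsum : ∀ l m : Fin 3, Summable fun d : ℤ × ℤ × ℤ =>
      ljSqDeriv (‖hcpSite a h d‖ ^ 2) * (hcpSite a h d l * hcpSite a h d m) := fun l m =>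
    (summable_hcpStressTerm ha hh l m).congr fun d => by by_cases hd : d = 0 <;> simp [hd, hcpSite_zero]
  have hval : ∀ l m : Fin 3, ∑' d : ℤ × ℤ × ℤ,
      ljSqDeriv (‖hcpSite a h d‖ ^ 2) * (hcpSite a h d l * hcpSite a h d m) = hcpSiteStress a h l m :=
    fun l m => tsum_congr fun d => by by_cases hd : d = 0 <;> simp [hd, hcpSite_zero]
  have hterm : ∀ d : ℤ × ℤ × ℤ, ljSqDeriv (‖hcpSite a h d‖ ^ 2) * inner ℝ (hcpSite a h d) x ^ 2 =
      ∑ l : Fin 3, ∑ m : Fin 3,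
        x l * x m * (ljSqDeriv (‖hcpSite a h d‖ ^ 2) * (hcpSite a h d l * hcpSite a h d m)) := fun d => by
    rw [inner_fin3]; simp only [Fin.sum_univ_three]; ring
  simp_rw [hterm]
  refine ⟨summable_sum fun l _ => summable_sum fun m _ => (hsum l m).mul_left _, ?_⟩
  rw [Summable.tsum_finsetSum fun l _ => summable_sum fun m _ => (hsum l m).mul_left _]
  refine Finset.sum_congr rfl fun l _ => ?_
  rw [Summable.tsum_finsetSum fun m _ => (hsum l m).mul_left _]
  refine Finset.sum_congr rfl fun m _ => ?_
  rw [tsum_mul_left, hval]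

/-! ## §7 One load line in `ℝ³`: antisymmetry, the single load, tails -/

/-- **Antisymmetry of a load line about the foot of the perpendicular.**  If `⟪v, e⟫ = (‖e‖²/2) N` with
`N ∈ ℤ`, the radial load read along `e`, `x ↦ W′(‖x‖²)⟪x, e⟫`, takes opposite values at the points `v + n e`
and `v + (−N − n) e` of the line. [folklore] -/
theorem h1_T_antisymm (v e : EuclideanSpace ℝ (Fin 3)) {N : ℤ} (hN : inner ℝ v e = ‖e‖ ^ 2 / 2 * N) (n : ℤ) :
    ljSqDeriv (‖v + ((-N - n : ℤ) : ℝ) • e‖ ^ 2) * inner ℝ (v + ((-N - n : ℤ) : ℝ) • e) e =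
      -(ljSqDeriv (‖v + (n : ℝ) • e‖ ^ 2) * inner ℝ (v + (n : ℝ) • e) e) := by
  have h1 : ‖v + ((-N - n : ℤ) : ℝ) • e‖ ^ 2 = ‖v + (n : ℝ) • e‖ ^ 2 := by
    rw [norm_add_sq_real, norm_add_sq_real, real_inner_smul_right, real_inner_smul_right, norm_smul,
      norm_smul, mul_pow, mul_pow, Real.norm_eq_abs, Real.norm_eq_abs, sq_abs, sq_abs, hN]
    push_cast
    ring
  have h2 : inner ℝ (v + ((-N - n : ℤ) : ℝ) • e) e = -inner ℝ (v + (n : ℝ) • e) e := by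
    rw [inner_add_left, inner_add_left, real_inner_smul_left, real_inner_smul_left,
      real_inner_self_eq_norm_sq, hN]
    push_cast
    ring
  rw [h1, h2]
  ring

/-- The single load `|W′(‖v‖²)⟪v, e⟫| ≤ C_W ‖e‖ ‖v‖⁻⁷` for `‖v‖ ≥ ρ₀`. [folklore] -/
theorem h1_T_abs_le {ρ₀ : ℝ} (hρ : 0 < ρ₀) {v : EuclideanSpace ℝ (Fin 3)} (hv : ρ₀ ≤ ‖v‖) (e : EuclideanSpace ℝ (Fin 3)) :
    |ljSqDeriv (‖v‖ ^ 2) * inner ℝ v e| ≤ 1 / 2 * (1 + ((ρ₀ ^ 2)⁻¹) ^ 3) * ‖e‖ * (‖v‖⁻¹) ^ 7 := by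
  have hvpos : 0 < ‖v‖ := hρ.trans_le hv
  have hW := h1_abs_ljSqDeriv_le (by positivity : (0 : ℝ) < ρ₀ ^ 2) (pow_le_pow_left₀ hρ.le hv 2)
  calc |ljSqDeriv (‖v‖ ^ 2) * inner ℝ v e| = |ljSqDeriv (‖v‖ ^ 2)| * |inner ℝ v e| := abs_mul _ _
    _ ≤ (1 / 2 * (1 + ((ρ₀ ^ 2)⁻¹) ^ 3) * ((‖v‖ ^ 2)⁻¹) ^ 4) * (‖v‖ * ‖e‖) :=
        mul_le_mul hW (abs_real_inner_le_norm _ _) (abs_nonneg _) (by positivity)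
    _ = 1 / 2 * (1 + ((ρ₀ ^ 2)⁻¹) ^ 3) * ‖e‖ * (‖v‖⁻¹) ^ 7 := by field_simp

/-- Summability on `ℤ` from two shifted one-sided tails. [folklore] -/
theorem h1_summable_int_of_tails {f : ℤ → ℝ} (K : ℕ) (hp : Summable fun m : ℕ => f ((m : ℤ) + K))
    (hn : Summable fun m : ℕ => f (-((m : ℤ) + K))) : Summable f := by
  refine Summable.of_nat_of_neg_add_one ?_ ?_
  · refine (summable_nat_add_iff K).1 ?_
    simpa using hp
  · refine (summable_nat_add_iff K).1 ?_
    refine ((summable_nat_add_iff 1).2 hn).congr fun m => ?_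
    push_cast
    ring_nf

/-- `‖v‖⁻⁶ ≤ (1 + ρ₀⁻¹)⁶ (1 + ‖v‖)⁻⁶` for `‖v‖ ≥ ρ₀ > 0`. [folklore] -/
theorem h1_inv_pow_le_one_add {ρ₀ : ℝ} (hρ : 0 < ρ₀) {v : EuclideanSpace ℝ (Fin 3)} (hv : ρ₀ ≤ ‖v‖) :
    (‖v‖⁻¹) ^ 6 ≤ (1 + ρ₀⁻¹) ^ 6 * ((1 + ‖v‖)⁻¹) ^ 6 := by
  have hvpos : 0 < ‖v‖ := hρ.trans_le hv
  rw [← mul_pow]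
  refine pow_le_pow_left₀ (by positivity) ?_ 6
  rw [le_mul_inv_iff₀ (by positivity : (0 : ℝ) < 1 + ‖v‖), mul_add, mul_one, inv_mul_cancel₀ hvpos.ne']
  linarith [inv_anti₀ hρ hv]

/-- `|Σ' g| ≤ Σ' |g|` for a summable real sequence. [folklore] -/
theorem h1_abs_tsum_le {g : ℕ → ℝ} (hg : Summable g) : |∑' m, g m| ≤ ∑' m, |g m| := by
  have := norm_tsum_le_tsum_norm hg.norm
  simpa only [Real.norm_eq_abs] using this

/-- Tails of a summable load line. [folklore] -/
theorem h1_line_tails {f : ℤ → ℝ} (hf : Summable f) :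
    (Summable fun m : ℕ => f m) ∧ (Summable fun m : ℕ => f ((m : ℤ) + 1)) ∧
      (Summable fun m : ℕ => f (-((m : ℤ) + 1))) ∧
      ∑' n : ℤ, f n = (∑' m : ℕ, f ((m : ℤ) + 1)) + f 0 + ∑' m : ℕ, f (-((m : ℤ) + 1)) := by
  have h1 : Summable fun m : ℕ => f ((m : ℤ) + 1) :=
    hf.comp_injective fun a b hab => by simpa using hab
  have h2 : Summable fun m : ℕ => f (-((m : ℤ) + 1)) :=
    hf.comp_injective fun a b hab => by simpa using hab
  exact ⟨hf.comp_injective Nat.cast_injective, h1, h2, tsum_of_add_one_of_neg_add_one h1 h2⟩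

/-- A family carrying a factor `u (t + d)` of a finitely supported field `u` is summable. [folklore] -/
theorem h1_summable_of_support {u : ℤ × ℤ × ℤ → EuclideanSpace ℝ (Fin 3)} (hu : (Function.support u).Finite) (t : ℤ × ℤ × ℤ) (g : (ℤ × ℤ × ℤ) → EuclideanSpace ℝ (Fin 3) → ℝ)
    (hg : ∀ d, g d 0 = 0) : Summable fun d => g d (u (t + d)) := by
  classical
  refine summable_of_ne_finset_zero (s := hu.toFinset.image fun x => x - t) fun d hd => ?_
  have : u (t + d) = 0 := by
    by_contra hne
    exact hd (Finset.mem_image.2 ⟨t + d, hu.mem_toFinset.2 (Function.mem_support.2 hne), by abel⟩)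
  rw [this, hg]

/-! ## Registered anchor of this file -/

/-- **Registered anchor `stub_coreFirstOrderDesignGeometry`** (helper file I of the H1 design `stub_coreFirstOrderDesign`;
expire once that stub lands): non-degeneracy of the hcp site map, `‖y_d‖ ≥ min a h` off the root. [folklore] -/
theorem stub_coreFirstOrderDesignGeometry :
    ∀ a h : ℝ, 0 < a → 0 < h → ∀ d : ℤ × ℤ × ℤ, d ≠ 0 → min a h ≤ ‖hcpSite a h d‖ :=
  fun _ _ ha hh _ hd => h1_norm_ge ha hh hd

end Summit.AtomisticToContinuum.Crystallization.Theorems.StrictSplittingRuleBirth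

end
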